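import Mathlib
import Summits.QuantumFields.BalabanUV.Beta.FP.PerfectFFBlockBounded
import Summits.QuantumFields.BalabanUV.Beta.GAN24.KPerfTailAmplitude

/-!
# Road «FP», row IR-5′ (c′) — FILE F6: the m-UNIFORM DECAY LETTER OF THE PERFECT ff BLOCK WITH AMPLITUDE `(Lc^m)²`:
# `Decays (blk (KPerf m) tt) (C₂·(Lc^m)²) (δ₁∕Lc^m)`, ONE `(δ₁, C₂)` FOR ALL `m ≥ 1` — sup letter (F5b) ∧ gan24's polynomial tail, interpolated

Cell `pub-balaban`, β sub-cell, binder row D1, road «FP» (owner `b2b-balaban-beta-d1-p3`), lane (U2) IR-5′ (unit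
`b2b-balaban-beta-d1-formalise-leaf-05`, gen 17).  The m-uniform SUP letter `|blk (KPerf m) tt| ≤ C₁` (F5b
`PerfectFFBlockBounded.abs_KPerf_ff_le`, `C₁ = γ₀(4,1)⁻¹·6⁵∕8`) and gan24's UNCONDITIONAL polynomial-amplitude tail
`Decays (KPerf m) (C₀·((Lc^m))⁶) (δ₀∕Lc^m)` (`GAN24/KPerfTailAmplitude.decays_KPerf_polyAmplitude`) combine, by the elementary
interpolation `min(C₁, C₀v³) ≤ max(C₀,C₁)·v` (`v = (Lc^m)²·e^{−(δ₀∕3)t}`), into the shape the far letter `hfar` of road FP's END asks of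
the ff leg for the words LINEAR in `Γ` (journal N-d1leaf05g16-1 ∕ owner Q-d1leaf05g16-2: «`C_Γ(m) ≲ (Lc^m)²`»):

  **`decays_blk_KPerf_ff_sq`**: `∃ δ₁ > 0, ∃ C₂ ≥ 0, ∀ m ≥ 1, Decays (blk (KPerf Lc (sfStep Lc) (smStep 3 Lc) m) true true) (C₂·((Lc:ℝ)^m)^2) (δ₁∕(Lc:ℝ)^m)`

with `δ₁ = δ₀∕3`, `C₂ = max C₀ C₁` (d = 3, `2 ≤ Lc`).  Together with the sup letter itself this also serves the BUBBLE word
(`Γ² ≤ C₁·C₂(Lc^m)²e^{−δ₁t∕Lc^m}`: `decays_sq_blk_KPerf_ff`).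

HONEST SCOPE: [our object] about an2's typed perfect resolvent; constants existential (gan24's `δ₀, C₀` are), d = 3; NOT `hfar` itself
(that is the END's binder about the fineHessA WORDS, whose other legs and the window bookkeeping are the ledger's), NOT hslice, NOT (ASYMP),
NOT D1; 0∕4 row-D1 binders; NOT BetaPertH, NOT continuum, NOT Clay.  HONEST DEPENDENCY: continuum YM on T⁴ ⇐ BetaPertH ∧ nine spine
estimates (0/9 proved); BetaPertH ⇐ (D1) ∧ (D4) ∧ CAP+tail; G-an2-4 gates asym, D1 and NE2/3/4.
-/

noncomputable section

open scoped BigOperators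

namespace Summit.QuantumFields.BalabanUV.Beta.FP.PerfectFFBlockDecay

open Literature.MathematicalPhysics.QuantumFieldTheory.Balaban1983to89
open Literature.MathematicalPhysics.QuantumFieldTheory.Balaban1983to89.Beta
open B12Sec2to5 (l1 l1_nonneg)
open ExpKernelCalculus (Decays)
open B5Prop11Lattice (gammaZero gammaZero_pos)
open Summit.QuantumFields.BalabanUV.Beta.GAN24.CombesThomas (sfStep smStep)
open Summit.QuantumFields.BalabanUV.Beta.FP.PerfectObjectsT (KPerf)
open Summit.QuantumFields.BalabanUV.Beta.D1BFx.PackedKernelSplit (blk blk_tt)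
open Summit.QuantumFields.BalabanUV.Beta.GAN24.KPerfTailAmplitude (decays_KPerf_polyAmplitude)
open Summit.QuantumFields.BalabanUV.Beta.FP.PerfectFFBlockBounded (abs_KPerf_ff_le CffSup_nonneg)

/-- the interpolation `a ≤ C₁`, `a ≤ C₀·v³`, `0 ≤ v` ⟹ `a ≤ max(C₀,C₁)·v`. [folklore] -/
theorem le_max_mul_of_le_of_le_mul_cube {a C₀ C₁ v : ℝ} (hv : 0 ≤ v) (hC₀ : 0 ≤ C₀) (hC₁ : 0 ≤ C₁)
    (h₁ : a ≤ C₁) (h₀ : a ≤ C₀ * v ^ 3) : a ≤ max C₀ C₁ * v := by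
  rcases le_or_gt v 1 with hv1 | hv1
  · have hv3 : v ^ 3 ≤ v := by
      have hv2 : v ^ 2 ≤ 1 := by nlinarith
      calc v ^ 3 = v ^ 2 * v := by ring
        _ ≤ 1 * v := mul_le_mul_of_nonneg_right hv2 hv
        _ = v := one_mul v
    calc a ≤ C₀ * v ^ 3 := h₀
      _ ≤ C₀ * v := mul_le_mul_of_nonneg_left hv3 hC₀
      _ ≤ max C₀ C₁ * v := mul_le_mul_of_nonneg_right (le_max_left _ _) hv
  · calc a ≤ C₁ := h₁
      _ ≤ C₁ * v := le_mul_of_one_le_right hC₁ hv1.le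
      _ ≤ max C₀ C₁ * v := mul_le_mul_of_nonneg_right (le_max_right _ _) hv

variable {Lc : ℕ} [NeZero Lc]

/-- [our object] **THE m-UNIFORM DECAY LETTER OF THE PERFECT ff BLOCK WITH AMPLITUDE `(Lc^m)²`** (d = 3, `2 ≤ Lc`):
`∃ δ₁ > 0, ∃ C₂ ≥ 0, ∀ m ≥ 1, Decays (blk (KPerf … m) true true) (C₂·((Lc:ℝ)^m)^2) (δ₁∕(Lc:ℝ)^m)`. -/
theorem decays_blk_KPerf_ff_sq (hLc : 2 ≤ Lc) : ∃ δ₁ C₂ : ℝ, 0 < δ₁ ∧ 0 ≤ C₂ ∧ ∀ m : ℕ, 1 ≤ m →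
    Decays (blk (KPerf (d := 3) Lc (sfStep Lc) (smStep 3 Lc) m) true true) (C₂ * ((Lc : ℝ) ^ m) ^ 2) (δ₁ / (Lc : ℝ) ^ m) := by
  obtain ⟨δ₀, C₀, hδ₀, hC₀, hD⟩ := decays_KPerf_polyAmplitude (Lc := Lc) hLc
  set C₁ : ℝ := (gammaZero (3 + 1) 1)⁻¹ * ((((3 : ℕ) : ℝ) + 3) ^ 5 / 8) with hC₁
  have hC₁0 : 0 ≤ C₁ := CffSup_nonneg 3
  refine ⟨δ₀ / 3, max C₀ C₁, by positivity, le_max_of_le_left hC₀, fun m hm x y a b => ?_⟩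
  rw [blk_tt]
  have hn : (0 : ℝ) < (Lc : ℝ) ^ m := by positivity
  set t : ℝ := l1 (x - y) with ht
  have ht0 : 0 ≤ t := l1_nonneg _
  -- the two letters
  have h₁ : |KPerf (d := 3) Lc (sfStep Lc) (smStep 3 Lc) m x y (Sum.inl a) (Sum.inl b)| ≤ C₁ := abs_KPerf_ff_le hLc hm x y a b
  have h₀ := hD m hm x y (Sum.inl a) (Sum.inl b)
  -- `v = n²·e^{−(δ₀/3)/n · t}`, `e^{−(δ₀/n)t} = (e^{−(δ₀/3)/n·t})³`
  set u : ℝ := Real.exp (-(δ₀ / 3 / (Lc : ℝ) ^ m) * t) with hu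
  have hu0 : 0 ≤ u := (Real.exp_pos _).le
  have hexp : Real.exp (-(δ₀ / (Lc : ℝ) ^ m) * t) = u ^ 3 := by
    rw [hu, ← Real.exp_nat_mul]
    congr 1
    push_cast
    ring
  have h₀' : |KPerf (d := 3) Lc (sfStep Lc) (smStep 3 Lc) m x y (Sum.inl a) (Sum.inl b)|
      ≤ C₀ * (((Lc : ℝ) ^ m) ^ 2 * u) ^ 3 := by
    rw [hexp] at h₀
    refine h₀.trans (le_of_eq ?_)
    ring
  have hv : 0 ≤ ((Lc : ℝ) ^ m) ^ 2 * u := by positivity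
  have key := le_max_mul_of_le_of_le_mul_cube hv hC₀ hC₁0 h₁ h₀'
  calc |KPerf (d := 3) Lc (sfStep Lc) (smStep 3 Lc) m x y (Sum.inl a) (Sum.inl b)|
      ≤ max C₀ C₁ * (((Lc : ℝ) ^ m) ^ 2 * u) := key
    _ = max C₀ C₁ * ((Lc : ℝ) ^ m) ^ 2 * Real.exp (-(δ₀ / 3 / (Lc : ℝ) ^ m) * l1 (x - y)) := by rw [hu, ht]; ring

/-- [our object] **THE BUBBLE CURRENCY**: the SQUARE of the perfect ff block decays with amplitude `C₁·C₂·(Lc^m)²` at rate `δ₁∕Lc^m`,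
uniformly in `m ≥ 1` (sup letter × decay letter). -/
theorem decays_sq_blk_KPerf_ff (hLc : 2 ≤ Lc) : ∃ δ₁ C₃ : ℝ, 0 < δ₁ ∧ 0 ≤ C₃ ∧ ∀ m : ℕ, 1 ≤ m →
    ∀ (x y : Fin (3 + 1) → ℤ) (a b : Fin (3 + 1)),
      (blk (KPerf (d := 3) Lc (sfStep Lc) (smStep 3 Lc) m) true true x y a b) ^ 2
        ≤ C₃ * ((Lc : ℝ) ^ m) ^ 2 * Real.exp (-(δ₁ / (Lc : ℝ) ^ m) * l1 (x - y)) := by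
  obtain ⟨δ₁, C₂, hδ₁, hC₂, hD⟩ := decays_blk_KPerf_ff_sq (Lc := Lc) hLc
  set C₁ : ℝ := (gammaZero (3 + 1) 1)⁻¹ * ((((3 : ℕ) : ℝ) + 3) ^ 5 / 8) with hC₁
  have hC₁0 : 0 ≤ C₁ := CffSup_nonneg 3
  refine ⟨δ₁, C₁ * C₂, hδ₁, mul_nonneg hC₁0 hC₂, fun m hm x y a b => ?_⟩
  have h₁ : |blk (KPerf (d := 3) Lc (sfStep Lc) (smStep 3 Lc) m) true true x y a b| ≤ C₁ := by
    rw [blk_tt]; exact abs_KPerf_ff_le hLc hm x y a b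
  have h₂ := hD m hm x y a b
  have hsq : (blk (KPerf (d := 3) Lc (sfStep Lc) (smStep 3 Lc) m) true true x y a b) ^ 2
      = |blk (KPerf (d := 3) Lc (sfStep Lc) (smStep 3 Lc) m) true true x y a b|
        * |blk (KPerf (d := 3) Lc (sfStep Lc) (smStep 3 Lc) m) true true x y a b| := by
    rw [← sq, sq_abs]
  rw [hsq]
  have hE : 0 ≤ C₂ * ((Lc : ℝ) ^ m) ^ 2 * Real.exp (-(δ₁ / (Lc : ℝ) ^ m) * l1 (x - y)) := by positivity
  calc |blk (KPerf (d := 3) Lc (sfStep Lc) (smStep 3 Lc) m) true true x y a b|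
        * |blk (KPerf (d := 3) Lc (sfStep Lc) (smStep 3 Lc) m) true true x y a b|
      ≤ C₁ * (C₂ * ((Lc : ℝ) ^ m) ^ 2 * Real.exp (-(δ₁ / (Lc : ℝ) ^ m) * l1 (x - y))) :=
        mul_le_mul h₁ h₂ (abs_nonneg _) hC₁0
    _ = C₁ * C₂ * ((Lc : ℝ) ^ m) ^ 2 * Real.exp (-(δ₁ / (Lc : ℝ) ^ m) * l1 (x - y)) := by ring

end Summit.QuantumFields.BalabanUV.Beta.FP.PerfectFFBlockDecay
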